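import Summits.ResolutionOfSingularities.ResolutionOfSingularities.Theorems.EquisingularLiftEquisingularLiftNatLiftableNoseClassDefs
import Summits.ResolutionOfSingularities.ResolutionOfSingularities.Theorems.EquisingularLiftEquisingularLiftNatNoseThenPointsOfLiftableCentre
import Summits.ResolutionOfSingularities.ResolutionOfSingularities.Theorems.EquisingularLiftEquisingularLiftNatLinearCentre
import Literature.AlgebraicGeometry.Resolution.BlowupDisjointCentreSplitting
import Literature.AlgebraicGeometry.Resolution.MarkedIdealsLemmas
import HarnessLib

/-!
# [OURS · L1 W4.5(b) · EL♮(3)] «UNION LIFT» — liftable centres are closed under finite DISJOINT unions; the v6‴ rung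
# `stub_elnat_liftableNoseThenPoints` («LIFTABLE NOSE CLASS, THEN POINTS») CLOSED

Cell `res-hironaka`, LADDER-RESOLUTION rung L (D-0089), slot W4.5(b); crux **EL♮(3)** `EquisingularLiftNatThree`
(stmt-ResolutionOfSingularities-20148) / parent EL♮ (stmt-20038); residue `stub_elnat_three_nonisolated_nondet` of res-L1-w45b-lead-2's
skeleton v10 / child v7; res-L1-w45b-plan-1 PLANNER-MEMO-g10-1 (8c1dc94511ba433d) object O2 «UnionLift» (census class C0a = (β): `Γ` smooth
but DISCONNECTED, e.g. two skew double lines — never ACM, so outside the v6′ DET-nose rung, and outside the v6 CI-nose rung). OURS; NOT a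
statement of any manuscript; AI-written, weaker than expert review. No definition, no `sorry`, standard axioms.
`--supports stmt-ResolutionOfSingularities-20148`; lands the REGISTERED rung stub `stub_elnat_liftableNoseThenPoints` of res-L1-w45b-lead-2's
skeleton v11 (20038) / child v8 (20148) BY NAME (text = L/res-L1-w45b-lead-2/TARGET-LIFTCLASS.sig.txt verbatim), via lead-2's own scratch
composition (L/res-L1-w45b-lead-2/LiftableNoseClassScratch.lean) with its one `sorry` (the union case) replaced by `liftableCentre_union`.

WHAT. The hLIFT clause of lead-2's class-independent closer `elnat_noseThenPoints_of_liftableCentre` (p525611) — «for every complete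
DVR `O ↠ k` there is an ideal sheaf `C` on `ℙⁿ_O` with `V(C) → Spec O` SMOOTH and `C · 𝒪_{ℙⁿ_k} = 𝓘_Z` along every graded `φ` over
`π`» — is CLOSED UNDER FINITE DISJOINT UNIONS of closed `Z` (`liftableCentre_union`): for lifts `C₁`, `C₂` of disjoint `Z₁`, `Z₂` take
`C := C₁ · C₂`. Two facts: (1) **`supp C₁ ∩ supp C₂ = ∅` upstairs** — a common point would have a specialisation in the special fibre
(`ℙⁿ_O → Spec O` is a closed map, being proper: `stub_projectiveAmbientSmoothProper`; the special fibre is the range of `Proj φ`, res-type-022's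
`LinearCentre.range_projMap_eq_specialFibre`), i.e. a point of `Z₁ ∩ Z₂`; (2) **`V(I·J) → S` is smooth when `V(I) → S`, `V(J) → S` are
and `supp I ∩ supp J = ∅`** (`smooth_subschemeι_mul_comp_of_disjoint_support`, any base `S`: smoothness is Zariski-local on the source and
over the open `X ∖ supp J` the closed subscheme `V(I·J)` IS `V(I)` — `(I·J)|_U = I|_U`, tree `comap_mul`; the comparison
`V(K) ∩ p⁻¹U ≅ V(K|_U)` is Mathlib's `comapIso` + `pullbackRestrictIsoRestrict`). The trace is `(C₁C₂)·𝒪_{ℙⁿ_k} = 𝓘_{Z₁}·𝓘_{Z₂} = 𝓘_{Z₁ ∪ Z₂}`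
(`comap_mul`, res-type-002's `vanishingIdeal_sup_eq_mul_of_disjoint`).

USE. With the CI lift (`CILift.ciLift` p522728), the determinantal lift (`DetLift.detLift` p525911) and any later class (RatLift via
`SatLift.liftableCentre_of_saturatedLift`), every nose `Z` that is a finite disjoint union of liftable pieces is liftable, UNCONDITIONALLY
(res-type-027's `H¹(𝒩) = 0` rung covers unions only modulo [Hartshorne2010, Thm. 22.3] and misses complete-intersection pieces with `H¹(𝒩) ≠ 0`).

References: R. Hartshorne, *Algebraic Geometry* (1977), II Thm. 4.9, III Thm. 10.2 [Hartshorne1977]; Stacks 01V9, 080A [StacksProject];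
cell: PLANNER-MEMO-g10-1 §1 C0a (index only, OURS).
-/

set_option linter.dupNamespace false -- mandated namespace `Summit.<Summit>.<Problem>` of this single-conjunct summit
set_option linter.overlappingInstances false -- signatures carry `[IsDomain O] [IsDiscreteValuationRing O]` as in the hLIFT clause of p525611

noncomputable section

open CategoryTheory CategoryTheory.Limits AlgebraicGeometry TopologicalSpace IsLocalRing
open MvPolynomial
open Literature.AlgebraicGeometry.Resolution
open Summit.ResolutionOfSingularities.ResolutionOfSingularities.Cruxes.EquisingularLift.StrataSplit

attribute [local instance] MvPolynomial.gradedAlgebra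

namespace Summit.ResolutionOfSingularities.ResolutionOfSingularities.Cruxes.EquisingularLiftNat.Sections

namespace UnionLift

universe u

/-! ## §1 Closed subschemes restricted to an open: `V(K) ∩ p⁻¹U ≅ V(K|_U)` -/

section Restrict

variable {X S : Scheme.{u}} (q : X ⟶ S) (K : X.IdealSheafData) (V : X.Opens)

/-- **`V(K) ∩ K⁻¹V ≅ V(K|_V)` over `V ⊆ X`**: for a morphism property `P` respecting isomorphisms, `P` holds for
`(V(K) ∩ ι⁻¹V) → V(K) → X → S` iff it holds for `V(K|_V) → V → X → S` (Mathlib `IdealSheafData.comapIso` and `pullbackRestrictIsoRestrict`).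
[cite: StacksProject, Tag 01V9] -/
theorem iff_comap_of_respectsIso (P : MorphismProperty Scheme.{u}) [P.RespectsIso] :
    P ((K.subschemeι ⁻¹ᵁ V).ι ≫ K.subschemeι ≫ q) ↔ P ((K.comap V.ι).subschemeι ≫ V.ι ≫ q) := by
  let e : (K.comap V.ι).subscheme ≅ (K.subschemeι ⁻¹ᵁ V : Scheme.{u}) :=
    K.comapIso V.ι ≪≫ pullbackSymmetry V.ι K.subschemeι ≪≫ pullbackRestrictIsoRestrict K.subschemeι V
  have he : e.hom ≫ (K.subschemeι ⁻¹ᵁ V).ι ≫ K.subschemeι = (K.comap V.ι).subschemeι ≫ V.ι := by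
    simp only [e, Iso.trans_hom, Category.assoc]
    rw [pullbackRestrictIsoRestrict_hom_ι_assoc, pullbackSymmetry_hom_comp_fst_assoc, ← pullback.condition,
      Scheme.IdealSheafData.comapIso_hom_fst_assoc]
  rw [← P.cancel_left_of_respectsIso e.hom, ← Category.assoc e.hom, ← Category.assoc (e.hom ≫ _)]
  rw [show (e.hom ≫ (K.subschemeι ⁻¹ᵁ V).ι) ≫ K.subschemeι = (K.comap V.ι).subschemeι ≫ V.ι by rw [Category.assoc, he],
    Category.assoc]

end Restrict

/-! ## §2 `V(I·J) → S` is smooth for disjoint `V(I)`, `V(J)` smooth over `S` -/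

section SmoothMul

variable {X S : Scheme.{u}} (q : X ⟶ S) (I J : X.IdealSheafData)

/-- Over an open `U` missing the support of `J`, the product `I · J` restricts to `I`. [cite: StacksProject, Tag 080A] -/
theorem comap_mul_eq_left_of_disjoint (U : X.Opens) (hU : Disjoint (U : Set X) J.support) :
    (I * J).comap U.ι = I.comap U.ι := by
  have hJ : J.comap U.ι = ⊤ := by
    rw [← Scheme.IdealSheafData.support_eq_bot_iff, Scheme.IdealSheafData.support_comap, eq_bot_iff]
    rintro x (hx : (U.ι x) ∈ (J.support : Set X))
    exact absurd hx (Set.disjoint_left.mp hU x.2)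
  rw [comap_mul, hJ, Scheme.IdealSheafData.mul_top]

/-- Over an open `U` missing the support of `I`, the product `I · J` restricts to `J`. [cite: StacksProject, Tag 080A] -/
theorem comap_mul_eq_right_of_disjoint (U : X.Opens) (hU : Disjoint (U : Set X) I.support) :
    (I * J).comap U.ι = J.comap U.ι := by
  rw [mul_comm]; exact comap_mul_eq_left_of_disjoint J I U hU

variable {I J} in
/-- **`V(I·J) → S` is SMOOTH when `V(I) → S` and `V(J) → S` are smooth and `supp I ∩ supp J = ∅`.** Smoothness is Zariski-local on the
source (Mathlib `IsZariskiLocalAtSource`); over `X ∖ supp J` the closed subscheme `V(I·J)` is `V(I)` restricted (`comap_mul_eq_left_of_disjoint`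
+ `iff_comap_of_respectsIso`), and symmetrically. [cite: StacksProject, Tag 01V9] -/
theorem smooth_subschemeι_mul_comp_of_disjoint_support (hd : Disjoint (I.support : Set X) J.support)
    (hI : Smooth (I.subschemeι ≫ q)) (hJ : Smooth (J.subschemeι ≫ q)) : Smooth ((I * J).subschemeι ≫ q) := by
  -- the two open complements
  let U₁ : X.Opens := ⟨(J.support : Set X)ᶜ, J.support.isClosed.isOpen_compl⟩
  let U₂ : X.Opens := ⟨(I.support : Set X)ᶜ, I.support.isClosed.isOpen_compl⟩
  have hU₁ : Disjoint (U₁ : Set X) J.support := disjoint_compl_left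
  have hU₂ : Disjoint (U₂ : Set X) I.support := disjoint_compl_left
  -- they cover `V(I·J)`
  have hcov : (⨆ b : Bool, (I * J).subschemeι ⁻¹ᵁ (cond b U₁ U₂)) = ⊤ := by
    refine top_le_iff.mp fun x _ => Opens.mem_iSup.mpr ?_
    by_cases hx : (I * J).subschemeι x ∈ (J.support : Set X)
    · exact ⟨false, fun h => Set.disjoint_left.mp hd h hx⟩
    · exact ⟨true, hx⟩
  refine IsZariskiLocalAtSource.of_iSup_eq_top (P := @Smooth) _ hcov fun b => ?_
  cases b
  · -- over `X ∖ supp I`: `V(I·J) = V(J)`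
    change Smooth (((I * J).subschemeι ⁻¹ᵁ U₂).ι ≫ (I * J).subschemeι ≫ q)
    rw [iff_comap_of_respectsIso q (I * J) U₂ @Smooth, comap_mul_eq_right_of_disjoint I J U₂ hU₂,
      ← iff_comap_of_respectsIso q J U₂ @Smooth]
    exact IsZariskiLocalAtSource.comp hJ _
  · -- over `X ∖ supp J`: `V(I·J) = V(I)`
    change Smooth (((I * J).subschemeι ⁻¹ᵁ U₁).ι ≫ (I * J).subschemeι ≫ q)
    rw [iff_comap_of_respectsIso q (I * J) U₁ @Smooth, comap_mul_eq_left_of_disjoint I J U₁ hU₁,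
      ← iff_comap_of_respectsIso q I U₁ @Smooth]
    exact IsZariskiLocalAtSource.comp hI _

end SmoothMul

/-! ## §3 Closed subsets of `ℙⁿ_O` with disjoint special fibres are disjoint -/

section SpecialFibre

variable {O k : Type} [CommRing O] [IsLocalRing O] [Field k] (π : O →+* k) (hπ : Function.Surjective π) {n : ℕ}
  (φ : (homogeneousSubmodule (Fin (n + 1)) O) →+*ᵍ (homogeneousSubmodule (Fin (n + 1)) k))
  (hφ : ∀ s, φ s = MvPolynomial.map π s)
  (hφ' : HomogeneousIdeal.irrelevant (homogeneousSubmodule (Fin (n + 1)) k) ≤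
    (HomogeneousIdeal.irrelevant (homogeneousSubmodule (Fin (n + 1)) O)).map φ)

include hπ hφ in
/-- **A non-empty closed subset of `ℙⁿ_O` (`O` local) meets the special fibre**, i.e. contains a point of the range of
`Proj φ : ℙⁿ_k → ℙⁿ_O`: its image under the proper, hence closed, structure map `ℙⁿ_O → Spec O` is closed and non-empty, so contains
the closed point. [cite: Hartshorne1977, II Thm. 4.9] -/
theorem exists_mem_range_projMap_of_isClosed (W : Set (Proj (homogeneousSubmodule (Fin (n + 1)) O))) (hW : IsClosed W)
    (hne : W.Nonempty) : ∃ y : Proj (homogeneousSubmodule (Fin (n + 1)) k), Proj.map φ hφ' y ∈ W := by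
  obtain ⟨-, hpr⟩ := stub_projectiveAmbientSmoothProper O n
  haveI := hpr
  set q := Proj.toSpecZero (homogeneousSubmodule (Fin (n + 1)) O) ≫
    Spec.map (CommRingCat.ofHom (algebraMap O ((homogeneousSubmodule (Fin (n + 1)) O) 0))) with hq
  obtain ⟨x, hx⟩ := hne
  have hcl : IsClosed (q '' W) := q.isClosedMap W hW
  have hmem : IsLocalRing.closedPoint O ∈ q '' W :=
    (IsLocalRing.specializes_closedPoint (q x)).mem_closed hcl ⟨x, hx, rfl⟩
  obtain ⟨w, hwW, hw⟩ := hmem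
  have hw' : w ∈ Set.range (Proj.map φ hφ') := by
    rw [LinearCentre.range_projMap_eq_specialFibre π hπ φ hφ hφ']
    exact hw
  obtain ⟨y, rfl⟩ := hw'
  exact ⟨y, hwW⟩

include hπ hφ in
/-- **Ideal sheaves on `ℙⁿ_O` whose traces on `ℙⁿ_k` have disjoint supports have disjoint supports.** [cite: Hartshorne1977, II Thm. 4.9] -/
theorem disjoint_support_of_disjoint_support_comap (C₁ C₂ : (Proj (homogeneousSubmodule (Fin (n + 1)) O)).IdealSheafData)
    (hd : Disjoint ((C₁.comap (Proj.map φ hφ')).support : Set (Proj (homogeneousSubmodule (Fin (n + 1)) k)))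
      (C₂.comap (Proj.map φ hφ')).support) :
    Disjoint (C₁.support : Set (Proj (homogeneousSubmodule (Fin (n + 1)) O))) C₂.support := by
  rw [Set.disjoint_iff_inter_eq_empty]
  by_contra hne
  obtain ⟨y, hy₁, hy₂⟩ := exists_mem_range_projMap_of_isClosed π hπ φ hφ hφ' _
    (C₁.support.isClosed.inter C₂.support.isClosed) (Set.nonempty_iff_ne_empty.mpr hne)
  have h1 : y ∈ ((C₁.comap (Proj.map φ hφ')).support : Set (Proj (homogeneousSubmodule (Fin (n + 1)) k))) := by
    rw [Scheme.IdealSheafData.support_comap]; exact hy₁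
  have h2 : y ∈ ((C₂.comap (Proj.map φ hφ')).support : Set (Proj (homogeneousSubmodule (Fin (n + 1)) k))) := by
    rw [Scheme.IdealSheafData.support_comap]; exact hy₂
  exact Set.disjoint_left.mp hd h1 h2

end SpecialFibre

/-! ## §4 UNION LIFT -/

/-- **UNION LIFT (explicit form).** `k` a field, `Z₁, Z₂ ⊆ ℙⁿ_k` DISJOINT closed subsets each
satisfying the hLIFT clause of lead-2's `elnat_noseThenPoints_of_liftableCentre` (p525611): «for every complete DVR `O` with algebraically
closed residue field and `π : O ↠ k`, an ideal sheaf `C` on `ℙⁿ_O` with `V(C) → Spec O` SMOOTH and `C.comap (Proj.map φ hφ') = 𝓘_Z` for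
every graded `φ` over `π`». THEN `Z₁ ∪ Z₂` satisfies the same clause, with `C := C₁ · C₂`: smooth by `smooth_subschemeι_mul_comp_of_disjoint_support`
(the supports are disjoint upstairs by `disjoint_support_of_disjoint_support_comap`), trace `𝓘_{Z₁} · 𝓘_{Z₂} = 𝓘_{Z₁ ∪ Z₂}` (tree `comap_mul`,
`vanishingIdeal_sup_eq_mul_of_disjoint`). [cite: StacksProject, Tag 080A; Hartshorne1977, III Thm. 10.2] -/
theorem exists_lift_union (k : Type) [Field k] (n : ℕ)
    (Z₁ Z₂ : Set (Proj (MvPolynomial.homogeneousSubmodule (Fin (n + 1)) k))) (hZ₁ : IsClosed Z₁) (hZ₂ : IsClosed Z₂)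
    (hdisj : Disjoint Z₁ Z₂) (hZ : IsClosed (Z₁ ∪ Z₂))
    (h₁ : ∀ (O : Type) [CommRing O] [IsDomain O] [IsDiscreteValuationRing O] [IsAdicComplete (IsLocalRing.maximalIdeal O) O]
      [IsAlgClosed (IsLocalRing.ResidueField O)] (π : O →+* k), Function.Surjective π →
      (letI := MvPolynomial.gradedAlgebra (σ := Fin (n + 1)) (R := O); letI := MvPolynomial.gradedAlgebra (σ := Fin (n + 1)) (R := k);
      ∃ C : (AlgebraicGeometry.Proj (MvPolynomial.homogeneousSubmodule (Fin (n + 1)) O)).IdealSheafData,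
        AlgebraicGeometry.Smooth (C.subschemeι ≫
          (Proj.toSpecZero (MvPolynomial.homogeneousSubmodule (Fin (n + 1)) O) ≫
            Spec.map (CommRingCat.ofHom (algebraMap O ((MvPolynomial.homogeneousSubmodule (Fin (n + 1)) O) 0))))) ∧
        ∀ (φ : (MvPolynomial.homogeneousSubmodule (Fin (n + 1)) O) →+*ᵍ (MvPolynomial.homogeneousSubmodule (Fin (n + 1)) k))
          (hφ' : HomogeneousIdeal.irrelevant (MvPolynomial.homogeneousSubmodule (Fin (n + 1)) k) ≤
            (HomogeneousIdeal.irrelevant (MvPolynomial.homogeneousSubmodule (Fin (n + 1)) O)).map φ),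
          (∀ s, φ s = MvPolynomial.map π s) →
          C.comap (AlgebraicGeometry.Proj.map φ hφ') =
            AlgebraicGeometry.Scheme.IdealSheafData.vanishingIdeal
              (⟨Z₁, hZ₁⟩ : TopologicalSpace.Closeds (Proj (MvPolynomial.homogeneousSubmodule (Fin (n + 1)) k)))))
    (h₂ : ∀ (O : Type) [CommRing O] [IsDomain O] [IsDiscreteValuationRing O] [IsAdicComplete (IsLocalRing.maximalIdeal O) O]
      [IsAlgClosed (IsLocalRing.ResidueField O)] (π : O →+* k), Function.Surjective π →
      (letI := MvPolynomial.gradedAlgebra (σ := Fin (n + 1)) (R := O); letI := MvPolynomial.gradedAlgebra (σ := Fin (n + 1)) (R := k);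
      ∃ C : (AlgebraicGeometry.Proj (MvPolynomial.homogeneousSubmodule (Fin (n + 1)) O)).IdealSheafData,
        AlgebraicGeometry.Smooth (C.subschemeι ≫
          (Proj.toSpecZero (MvPolynomial.homogeneousSubmodule (Fin (n + 1)) O) ≫
            Spec.map (CommRingCat.ofHom (algebraMap O ((MvPolynomial.homogeneousSubmodule (Fin (n + 1)) O) 0))))) ∧
        ∀ (φ : (MvPolynomial.homogeneousSubmodule (Fin (n + 1)) O) →+*ᵍ (MvPolynomial.homogeneousSubmodule (Fin (n + 1)) k))
          (hφ' : HomogeneousIdeal.irrelevant (MvPolynomial.homogeneousSubmodule (Fin (n + 1)) k) ≤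
            (HomogeneousIdeal.irrelevant (MvPolynomial.homogeneousSubmodule (Fin (n + 1)) O)).map φ),
          (∀ s, φ s = MvPolynomial.map π s) →
          C.comap (AlgebraicGeometry.Proj.map φ hφ') =
            AlgebraicGeometry.Scheme.IdealSheafData.vanishingIdeal
              (⟨Z₂, hZ₂⟩ : TopologicalSpace.Closeds (Proj (MvPolynomial.homogeneousSubmodule (Fin (n + 1)) k))))) :
    ∀ (O : Type) [CommRing O] [IsDomain O] [IsDiscreteValuationRing O] [IsAdicComplete (IsLocalRing.maximalIdeal O) O]
      [IsAlgClosed (IsLocalRing.ResidueField O)] (π : O →+* k), Function.Surjective π →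
      (letI := MvPolynomial.gradedAlgebra (σ := Fin (n + 1)) (R := O); letI := MvPolynomial.gradedAlgebra (σ := Fin (n + 1)) (R := k);
      ∃ C : (AlgebraicGeometry.Proj (MvPolynomial.homogeneousSubmodule (Fin (n + 1)) O)).IdealSheafData,
        AlgebraicGeometry.Smooth (C.subschemeι ≫
          (Proj.toSpecZero (MvPolynomial.homogeneousSubmodule (Fin (n + 1)) O) ≫
            Spec.map (CommRingCat.ofHom (algebraMap O ((MvPolynomial.homogeneousSubmodule (Fin (n + 1)) O) 0))))) ∧
        ∀ (φ : (MvPolynomial.homogeneousSubmodule (Fin (n + 1)) O) →+*ᵍ (MvPolynomial.homogeneousSubmodule (Fin (n + 1)) k))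
          (hφ' : HomogeneousIdeal.irrelevant (MvPolynomial.homogeneousSubmodule (Fin (n + 1)) k) ≤
            (HomogeneousIdeal.irrelevant (MvPolynomial.homogeneousSubmodule (Fin (n + 1)) O)).map φ),
          (∀ s, φ s = MvPolynomial.map π s) →
          C.comap (AlgebraicGeometry.Proj.map φ hφ') =
            AlgebraicGeometry.Scheme.IdealSheafData.vanishingIdeal
              (⟨Z₁ ∪ Z₂, hZ⟩ : TopologicalSpace.Closeds (Proj (MvPolynomial.homogeneousSubmodule (Fin (n + 1)) k)))) := by
  intro O _ _ _ _ _ π hπ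
  obtain ⟨C₁, hsm₁, hK₁⟩ := h₁ O π hπ
  obtain ⟨C₂, hsm₂, hK₂⟩ := h₂ O π hπ
  -- a coefficient map `φ₀` over `π` to compare supports (the statement's first conjunct is `φ`-free)
  let φ₀ : (homogeneousSubmodule (Fin (n + 1)) O) →+*ᵍ (homogeneousSubmodule (Fin (n + 1)) k) :=
    ⟨MvPolynomial.map π, fun h => h.map π⟩
  have hφ₀ : ∀ s, φ₀ s = MvPolynomial.map π s := fun _ => rfl
  have hφ₀' := ProjectiveAmbientFibre.irrelevant_le_map_gradedMap π φ₀ hφ₀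
  -- the supports are disjoint upstairs
  have hd : Disjoint (C₁.support : Set (Proj (homogeneousSubmodule (Fin (n + 1)) O))) C₂.support := by
    refine disjoint_support_of_disjoint_support_comap π hπ φ₀ hφ₀ hφ₀' C₁ C₂ ?_
    rw [hK₁ φ₀ hφ₀' hφ₀, hK₂ φ₀ hφ₀' hφ₀, Scheme.IdealSheafData.coe_support_vanishingIdeal,
      Scheme.IdealSheafData.coe_support_vanishingIdeal]
    exact hdisj
  refine ⟨C₁ * C₂, smooth_subschemeι_mul_comp_of_disjoint_support _ hd hsm₁ hsm₂, fun φ hφ' hφ => ?_⟩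
  have hsup : (⟨Z₁ ∪ Z₂, hZ⟩ : Closeds (Proj (homogeneousSubmodule (Fin (n + 1)) k))) = ⟨Z₁, hZ₁⟩ ⊔ ⟨Z₂, hZ₂⟩ :=
    Closeds.ext (by simp [Closeds.coe_sup])
  rw [comap_mul, hK₁ φ hφ' hφ, hK₂ φ hφ' hφ, hsup, vanishingIdeal_sup_eq_mul_of_disjoint]
  exact hdisj

end UnionLift

/-! ## §5 The named form, the class lift, and the v6‴ rung closer -/

/-- **UNION LIFT — `IsLiftableCentre` is closed under finite DISJOINT unions** (the signature asked for by res-L1-w45b-lead-2, 2026-08-27T12:22:39Z,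
over the named predicate `IsLiftableCentre` of `…NatLiftableNoseClassDefs` p530164 = the hLIFT clause of p525611 verbatim).
[cite: StacksProject, Tag 080A; Hartshorne1977, III Thm. 10.2] -/
theorem liftableCentre_union (k : Type) [Field k] (n : ℕ)
    {Z₁ Z₂ : Set (Literature.AlgebraicGeometry.Motives.projectiveSpace n k).left} (h₁ : IsClosed Z₁) (h₂ : IsClosed Z₂) :
    IsLiftableCentre k n Z₁ h₁ → IsLiftableCentre k n Z₂ h₂ → Z₁ ∩ Z₂ = ∅ → IsLiftableCentre k n (Z₁ ∪ Z₂) (h₁.union h₂) := by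
  intro hl₁ hl₂ hdisj
  exact UnionLift.exists_lift_union k n Z₁ Z₂ h₁ h₂ (Set.disjoint_iff_inter_eq_empty.mpr hdisj) (h₁.union h₂) hl₁ hl₂

/-- **The liftable nose class lifts**: every member of lead-2's inductive DOWNSTAIRS class `IsLiftableNoseClass` (ci / det / disjoint union) is a
liftable centre — cases `ci` and `det` are res-D-pv-027's `CILift.ciLift` (p522728) and res-type-097's `DetLift.detLift` (p525911) (lead-2's scratch
composition, which elaborates), case `union` is `liftableCentre_union`. [cite: Hartshorne1977, III Prop. 9.7 and Thm. 10.2] -/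
theorem lift_of_isLiftableNoseClass (k : Type) [Field k] [IsAlgClosed k] (n : ℕ)
    {Z : Set (Literature.AlgebraicGeometry.Motives.projectiveSpace n k).left} (h : IsLiftableNoseClass k n Z) (hZ : IsClosed Z) :
    IsLiftableCentre k n Z hZ := by
  -- adapted from res-L1-w45b-lead-2's L/res-L1-w45b-lead-2/LiftableNoseClassScratch.lean (`lift_of_isLiftableNoseClass_SCRATCH`)
  induction h with
  | ci c f d h =>
    obtain ⟨hfd, hne, hjac, hSig⟩ := h
    intro O _ _ _ _ _ π hπ
    exact CILift.ciLift k n O π hπ c f d hfd hne hjac hZ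
  | det t M α β h =>
    obtain ⟨hM, hjac, hSig⟩ := h
    intro O _ _ _ _ _ π hπ
    exact DetLift.detLift k n O π hπ t M α β hM hjac hZ
  | union Z₁ Z₂ h₁ h₂ hdisj ih₁ ih₂ =>
    exact liftableCentre_union k n h₁.isClosed h₂.isClosed (ih₁ h₁.isClosed) (ih₂ h₂.isClosed) hdisj

set_option linter.overlappingInstances false in
/-- **RUNG v6‴ «LIFTABLE NOSE CLASS, THEN POINTS» — the registered stub `stub_elnat_liftableNoseThenPoints` of res-L1-w45b-lead-2's skeleton v11
(stmt-ResolutionOfSingularities-20038) / child v8 (stmt-…-20148), text = L/res-L1-w45b-lead-2/TARGET-LIFTCLASS.sig.txt VERBATIM.** DOWNSTAIRS-ONLY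
hypothesis: a closed `Z` in the liftable nose class (`IsLiftableNoseClass`: smooth complete intersections, smooth determinantal loci, disjoint unions),
`Z ⊆ ι(H)`, `ι(H) ⊄ Z`, the blow-up of `ℙⁿ_k` along `𝓘_Z`, then a point-only resolution of the running reduced strict transform ⇒ the horizontal EL♮
conclusion. Proof = lead-2's class-independent closer `elnat_noseThenPoints_of_liftableCentre` (p525611) at the liftable centre
`lift_of_isLiftableNoseClass`. OURS; not a statement of any manuscript. [cite: Hartshorne1977, III Prop. 9.7 and Thm. 10.2; StacksProject, Tag 01V8] -/
theorem stub_elnat_liftableNoseThenPoints (p : ℕ) : p.Prime → ∀ (k : Type) [Field k] [CharP k p] [IsAlgClosed k] (n : ℕ) (H : AlgebraicGeometry.Scheme.{0}) (ι : H ⟶ (Literature.AlgebraicGeometry.Motives.projectiveSpace n k).left), AlgebraicGeometry.IsClosedImmersion ι → AlgebraicGeometry.IsIntegral H → (∀ y : (Literature.AlgebraicGeometry.Motives.projectiveSpace n k).left, ∃ U : (Literature.AlgebraicGeometry.Motives.projectiveSpace n k).left.affineOpens, y ∈ (U : (Literature.AlgebraicGeometry.Motives.projectiveSpace n k).left.Opens)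 ∧ (ι.ker.ideal U).IsPrincipal) → (∃ (Z : Set (Literature.AlgebraicGeometry.Motives.projectiveSpace n k).left) (hZ : IsClosed Z), IsLiftableNoseClass k n Z ∧ Z ⊆ Set.range ι ∧ ¬ (Set.range ι ⊆ Z) ∧ (∃ (F₂ : AlgebraicGeometry.Scheme.{0}) (υ : F₂ ⟶ (Literature.AlgebraicGeometry.Motives.projectiveSpace n k).left), Literature.AlgebraicGeometry.Resolution.IsBlowup υ (AlgebraicGeometry.Scheme.IdealSheafData.vanishingIdeal (⟨Z, hZ⟩ : TopologicalSpace.Closeds (Literature.AlgebraicGeometry.Motives.projectiveSpace n k).left)) ∧ ∃ (F' : AlgebraicGeometry.Scheme.{0}) (ρ' : F' ⟶ F₂) (T' : Set F'), (∀ Q : (∀ F₁ : AlgebraicGeometry.Scheme.{0}, (F₁ ⟶ F₂) → Set F₁ → Prop), Q F₂ (CategoryTheory.CategoryStruct.id F₂) (closure (υ ⁻¹' (Set.range ι \ Z))) → (∀ (F₁ F₃ : AlgebraicGeometry.Scheme.{0}) (ρ : F₁ ⟶ F₂) (T₁ : Set F₁) (x : ↥((AlgebraicGeometry.Scheme.IdealSheafData.vanishingIdeal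 (⟨closure T₁, isClosed_closure⟩ : TopologicalSpace.Closeds F₁))).subscheme) (υ₁ : F₃ ⟶ F₁) (hx : IsClosed ({(((AlgebraicGeometry.Scheme.IdealSheafData.vanishingIdeal (⟨closure T₁, isClosed_closure⟩ : TopologicalSpace.Closeds F₁))).subschemeι x : F₁)} : Set F₁)), Q F₁ ρ T₁ → ¬ IsRegularLocalRing (((AlgebraicGeometry.Scheme.IdealSheafData.vanishingIdeal (⟨closure T₁, isClosed_closure⟩ : TopologicalSpace.Closeds F₁))).subscheme.presheaf.stalk x) → Literature.AlgebraicGeometry.Resolution.IsBlowup υ₁ (AlgebraicGeometry.Scheme.IdealSheafData.vanishingIdeal (⟨{(((AlgebraicGeometry.Scheme.IdealSheafData.vanishingIdeal (⟨closure T₁, isClosed_closure⟩ : TopologicalSpace.Closeds F₁))).subschemeι x : F₁)}, hx⟩ : TopologicalSpace.Closeds F₁)) → Q F₃ (CategoryTheory.CategoryStruct.comp υ₁ ρ) (closure (υ₁ ⁻¹' (T₁ \ {(((AlgebraicGeometry.Scheme.IdealSheafData.vanishingIdeal (⟨closure T₁, isClosed_closure⟩ : TopologicalSpace.Closeds F₁))).subschemeι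 x : F₁)})))) → Q F' ρ' T') ∧ Literature.AlgebraicGeometry.Resolution.Scheme.IsRegular (AlgebraicGeometry.Scheme.IdealSheafData.vanishingIdeal (⟨closure T', isClosed_closure⟩ : TopologicalSpace.Closeds F')).subscheme)) → ∃ (O : Type) (_ : CommRing O) (_ : IsDomain O) (_ : IsDiscreteValuationRing O) (_ : CharZero O) (π : O →+* k), Function.Surjective π ∧ (letI := MvPolynomial.gradedAlgebra (σ := Fin (n + 1)) (R := O); letI := MvPolynomial.gradedAlgebra (σ := Fin (n + 1)) (R := k); ∀ (φ : MvPolynomial.homogeneousSubmodule (Fin (n + 1)) O →+*ᵍ MvPolynomial.homogeneousSubmodule (Fin (n + 1)) k) (hφ' : HomogeneousIdeal.irrelevant (MvPolynomial.homogeneousSubmodule (Fin (n + 1)) k) ≤ (HomogeneousIdeal.irrelevant (MvPolynomial.homogeneousSubmodule (Fin (n + 1)) O)).map φ), (∀ s, φ s = MvPolynomial.map π s) → ∀ Y : Set (AlgebraicGeometry.Proj (MvPolynomial.homogeneousSubmodule (Fin (n + 1)) O)), Y = Set.range (CategoryTheory.CategoryStruct.comp ι (AlgebraicGeometry.Proj.map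 φ hφ') : H ⟶ (AlgebraicGeometry.Proj (MvPolynomial.homogeneousSubmodule (Fin (n + 1)) O))) → ∃ (P' : AlgebraicGeometry.Scheme.{0}) (σ : P' ⟶ (AlgebraicGeometry.Proj (MvPolynomial.homogeneousSubmodule (Fin (n + 1)) O))) (S' : Set P'), (∀ Q : (∀ X' : AlgebraicGeometry.Scheme.{0}, (X' ⟶ (AlgebraicGeometry.Proj (MvPolynomial.homogeneousSubmodule (Fin (n + 1)) O))) → Set X' → Prop), Q (AlgebraicGeometry.Proj (MvPolynomial.homogeneousSubmodule (Fin (n + 1)) O)) (CategoryTheory.CategoryStruct.id (AlgebraicGeometry.Proj (MvPolynomial.homogeneousSubmodule (Fin (n + 1)) O))) Y → (∀ (X' X'' : AlgebraicGeometry.Scheme.{0}) (σ' : X' ⟶ (AlgebraicGeometry.Proj (MvPolynomial.homogeneousSubmodule (Fin (n + 1)) O))) (Y' : Set X') (C : X'.IdealSheafData) (τ : X'' ⟶ X'), Q X' σ' Y' → Literature.AlgebraicGeometry.Resolution.IsBlowup τ C → Literature.AlgebraicGeometry.Resolution.Scheme.IsRegular C.subscheme → AlgebraicGeometry.Flat (CategoryTheory.CategoryStruct.comp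 C.subschemeι (CategoryTheory.CategoryStruct.comp σ' (CategoryTheory.CategoryStruct.comp (AlgebraicGeometry.Proj.toSpecZero (MvPolynomial.homogeneousSubmodule (Fin (n + 1)) O)) (AlgebraicGeometry.Spec.map (CommRingCat.ofHom (algebraMap O (MvPolynomial.homogeneousSubmodule (Fin (n + 1)) O 0))))))) → σ' '' (C.support : Set X') ⊆ {x | ¬ IsGenericPoint x Y} → (C.support : Set X') ∩ (CategoryTheory.CategoryStruct.comp σ' (CategoryTheory.CategoryStruct.comp (AlgebraicGeometry.Proj.toSpecZero (MvPolynomial.homogeneousSubmodule (Fin (n + 1)) O)) (AlgebraicGeometry.Spec.map (CommRingCat.ofHom (algebraMap O (MvPolynomial.homogeneousSubmodule (Fin (n + 1)) O 0)))))) ⁻¹' {IsLocalRing.closedPoint O} ⊆ Y' → Q X'' (CategoryTheory.CategoryStruct.comp τ σ') (closure (τ ⁻¹' (Y' \ (C.support : Set X'))))) → Q P' σ S') ∧ Literature.AlgebraicGeometry.Resolution.Scheme.IsRegular (AlgebraicGeometry.Scheme.IdealSheafData.vanishingIdeal (⟨closure S', isClosed_closure⟩ : TopologicalSpace.Closeds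 P')).subscheme) := by
  intro hp k _ _ _ n H ι hι hH hloc h
  obtain ⟨Z, hZ, hcls, hsub, hnsub, hdown⟩ := h
  exact elnat_noseThenPoints_of_liftableCentre p hp k n H ι hι hH hloc Z hZ hsub hnsub (lift_of_isLiftableNoseClass k n hcls hZ) hdown

end Summit.ResolutionOfSingularities.ResolutionOfSingularities.Cruxes.EquisingularLiftNat.Sections

end
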